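import Literature.Barriers.Parity.EquidistributionLimits
import Mathlib.NumberTheory.Bertrand
import HarnessLib

/-!
# Scope of the barrier `EquidistributionLimitBarrier` (Granville–Soundararajan 2007, Example 4):
# the void regimes

Audit companion (D-0021 barrier audit) of `Literature/Barriers/Parity/EquidistributionLimits.lean`.
The catalogued barrier `Literature.Barriers.Parity.EquidistributionLimitBarrier` (PROVED in the tree,
`EquidistributionLimitBarrier_holds`) says: for `u ≥ 1` there is `c(u) > 0` such that every subset
`𝒜` of the primes has, at every large scale `x`, a modulus `ℓ ≤ x/(log x)^u`, a `y ∈ (x/4, x)` and a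
reduced class `a (mod ℓ)` with `|𝒜(y; ℓ, a) - y𝒜(x)/(xφ(ℓ))| ≥ c 𝒜(x)/φ(ℓ)`
[cite: GranvilleSoundararajan2007Uncertainty, Example 4]. Everything below is PROVED (elementary:
pigeonhole and Bertrand's postulate; this file does not import the Maier-matrix proof); it records,
as theorems, how much of "every subset of the primes" carries arithmetic content. The companion
`EquidistributionLimitsTwoModuli.lean` gives the sharpened positive statement (two moduli fixed in
advance of the set, threshold uniform in the set).

## Void regimes (the conclusion holds for trivial reasons)

* **Sparse sets** (`irregularAt_of_sparse`, `irregular_of_eventually_sparse`,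
  `equidistributionLimit_sparseRegime`): if at the scale `x` some prime `ℓ ≤ x/(log x)^u` exceeds
  `𝒜(x) + 1`, then a reduced class `a (mod ℓ)` contains NO element of `𝒜` below `x` (pigeonhole,
  `exists_coprime_class_empty`), and at `y = x/2` the deviation from the main term is exactly
  `𝒜(x)/(2φ(ℓ))`: the conclusion holds with `c = 1/2` for EVERY set of naturals, prime or not, with
  no Maier matrix. By Bertrand's postulate this covers every `x` with `2(𝒜(x) + 2) ≤ x/(log x)^u`,
  i.e. every set with `𝒜(x) ≤ x/(2(log x)^u) - 2` eventually — at level `u` the barrier constrains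
  only sets with `limsup 𝒜(x)(log x)^u/x ≥ 1/2`; `irregular_of_rpow_bound` records the instance
  `𝒜(x) ≤ x^θ`, `θ < 1` (prime values of a polynomial of degree `≥ 2`, any set of relative density
  `O((log x)^{1-u-ε})` in the primes), void at EVERY level `u`.
* **Class-avoiding sets** (`irregularAt_of_avoids_class`, `irregular_of_avoids_class`): a set that
  never meets some reduced class `a (mod m)` satisfies the conclusion with `ℓ = m`, `c = 1/4` at every
  level `u` and every large `x` — the source's own remark "If we had chosen `𝒜` to be the primes
  `≡ 5 (mod 7)` then this is of no interest when we take `a = 1`, `ℓ = 7`"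
  [cite: GranvilleSoundararajan2007Uncertainty, §1a]; `irregular_of_subset_twinPrimes` is the
  instance `m = 3`, `a = 1` for every subset of the lesser twin primes, and the same holds for the
  prime values of any admissible system that misses a reduced class.

Consequently the barrier's subset clause has content only for subsets of the primes that are dense
at the level in question AND meet every reduced class to every modulus `≤ x/(log x)^u`; for
tuple-primes, polynomial prime values and sieve-selected sets of relative density `→ 0` at level
`u = 1` it blocks nothing (the only hypotheses it contradicts there are trivially false ones).

## Not here

The two-moduli form and the uniformity of `x₀` in `𝒜` (`EquidistributionLimitsTwoModuli.lean`);
the source's Theorems 5.1/5.2 for the primes themselves (every, resp. almost every, large modulus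
carries a deviation — no dichotomy) [cite: GranvilleSoundararajan2007Uncertainty, Theorems 5.1, 5.2],
which are not transcribed anywhere in the tree.
-/

noncomputable section

open Filter Finset

namespace Literature.Barriers.Parity

/-- The conclusion of `EquidistributionLimitBarrier` at one scale `x` for the set `𝒜`, exponent `u`
and constant `c` (local notation, literally the body of the barrier). -/
local notation3 "IrregularAt[" 𝒜 ", " u ", " c ", " x "]" =>
  ∃ ℓ : ℕ, 1 ≤ ℓ ∧ (ℓ : ℝ) ≤ x / Real.log x ^ (u : ℝ) ∧
    ∃ y : ℝ, x / 4 < y ∧ y < x ∧ ∃ a : ℕ, Nat.Coprime a ℓ ∧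
      (c : ℝ) * ((subsetCount 𝒜 x : ℝ) / (Nat.totient ℓ : ℝ)) ≤
        |(subsetCountMod 𝒜 ℓ a y : ℝ) - 1 / (Nat.totient ℓ : ℝ) * (y * (subsetCount 𝒜 x : ℝ) / x)|

/-- The local notation is literally the barrier's conclusion. [folklore] -/
theorem equidistributionLimitBarrier_iff_irregularAt :
    EquidistributionLimitBarrier ↔
      ∀ u : ℝ, 1 ≤ u → ∃ c : ℝ, 0 < c ∧ ∀ 𝒜 : Set ℕ, (∀ n ∈ 𝒜, n.Prime) →
        ∃ x₀ : ℝ, ∀ x : ℝ, x₀ ≤ x → IrregularAt[𝒜, u, c, x] :=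
  Iff.rfl

/-! ### The sparse regime: an empty reduced class -/

/-- **Pigeonhole.** If `ℓ` is prime and `𝒜(x) + 2 ≤ ℓ`, some reduced class `a (mod ℓ)` contains no
element of `𝒜` below `x` (the `𝒜(x)` elements occupy at most `𝒜(x) < ℓ - 1` of the `ℓ - 1` reduced
classes). Valid for every set of naturals. [folklore] -/
theorem exists_coprime_class_empty (𝒜 : Set ℕ) (x : ℝ) {ℓ : ℕ} (hℓ : ℓ.Prime)
    (h : subsetCount 𝒜 x + 2 ≤ ℓ) :
    ∃ a : ℕ, a.Coprime ℓ ∧ ∀ y : ℝ, y ≤ x → subsetCountMod 𝒜 ℓ a y = 0 := by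
  classical
  have hT : {n : ℕ | n ∈ 𝒜 ∧ (n : ℝ) ≤ x}.Finite := finite_subsetCount_set 𝒜 x
  set U : Finset ℕ := hT.toFinset.image (· % ℓ) with hU
  have hUcard : U.card ≤ subsetCount 𝒜 x := by
    calc U.card ≤ hT.toFinset.card := Finset.card_image_le
      _ = subsetCount 𝒜 x := by
          rw [subsetCount, Set.ncard_eq_toFinset_card _ hT]
  have hex : ∃ a ∈ Finset.Ico 1 ℓ, a ∉ U := by
    by_contra hcon
    push Not at hcon
    have hsub : Finset.Ico 1 ℓ ⊆ U := fun a ha => hcon a ha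
    have h1 := Finset.card_le_card hsub
    rw [Nat.card_Ico] at h1
    omega
  obtain ⟨a, ha, haU⟩ := hex
  rw [Finset.mem_Ico] at ha
  refine ⟨a, ?_, fun y hy => ?_⟩
  · exact (Nat.coprime_of_lt_prime (by omega) ha.2 hℓ).symm
  · have hempty : {n : ℕ | n ∈ 𝒜 ∧ (n : ℝ) ≤ y ∧ n ≡ a [MOD ℓ]} = ∅ := by
      ext n
      simp only [Set.mem_setOf_eq, Set.mem_empty_iff_false, iff_false, not_and]
      intro hn hny hmod
      apply haU
      rw [hU, Finset.mem_image]
      refine ⟨n, ?_, ?_⟩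
      · rw [Set.Finite.mem_toFinset]; exact ⟨hn, hny.trans hy⟩
      · rw [Nat.ModEq] at hmod
        rw [hmod, Nat.mod_eq_of_lt ha.2]
    simp [subsetCountMod, hempty]

/-- **Sparse regime, at one scale.** For ANY set of naturals `𝒜`, any `u`, any `x > 0` and any
prime `ℓ ≤ x/(log x)^u` with `𝒜(x) + 2 ≤ ℓ`, the conclusion of `EquidistributionLimitBarrier` holds
at `x` with `c = 1/2`: for the empty reduced class `a` and `y = x/2`,
`|𝒜(y; ℓ, a) - y𝒜(x)/(xφ(ℓ))| = 𝒜(x)/(2φ(ℓ))`. No primality and no Maier matrix is involved.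
[folklore] -/
theorem irregularAt_of_sparse (𝒜 : Set ℕ) (u : ℝ) {x : ℝ} (hx : 0 < x) {ℓ : ℕ}
    (hℓ : ℓ.Prime) (hℓx : (ℓ : ℝ) ≤ x / Real.log x ^ u) (h : subsetCount 𝒜 x + 2 ≤ ℓ) :
    IrregularAt[𝒜, u, (1 / 2 : ℝ), x] := by
  obtain ⟨a, ha, hzero⟩ := exists_coprime_class_empty 𝒜 x hℓ h
  refine ⟨ℓ, hℓ.one_lt.le, hℓx, x / 2, by linarith, by linarith, a, ha, ?_⟩
  rw [hzero (x / 2) (by linarith)]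
  have hφ : (0 : ℝ) < Nat.totient ℓ := by exact_mod_cast Nat.totient_pos.mpr hℓ.pos
  rw [Nat.cast_zero, zero_sub, abs_neg, abs_of_nonneg (by positivity)]
  apply le_of_eq
  field_simp

/-- **Sparse regime, eventually.** If `2(𝒜(x) + 2) ≤ x/(log x)^u` for all large `x` (e.g.
`𝒜(x) = o(x/(log x)^u)`), then the conclusion of `EquidistributionLimitBarrier` holds for `𝒜` at
every large `x` with `c = 1/2` — for every set of naturals (Bertrand's postulate supplies a prime
`ℓ ∈ (𝒜(x) + 2, 2(𝒜(x) + 2)]`). [folklore] -/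
theorem irregular_of_eventually_sparse (u : ℝ) (𝒜 : Set ℕ)
    (h𝒜 : ∀ᶠ x : ℝ in atTop, 2 * ((subsetCount 𝒜 x : ℝ) + 2) ≤ x / Real.log x ^ u) :
    ∃ x₀ : ℝ, ∀ x : ℝ, x₀ ≤ x → IrregularAt[𝒜, u, (1 / 2 : ℝ), x] := by
  obtain ⟨x₀, hx₀⟩ := eventually_atTop.mp (h𝒜.and (eventually_gt_atTop 0))
  refine ⟨x₀, fun x hx => ?_⟩
  obtain ⟨hsp, hxpos⟩ := hx₀ x hx
  obtain ⟨ℓ, hℓp, hlt, hle⟩ :=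
    Nat.exists_prime_lt_and_le_two_mul (subsetCount 𝒜 x + 2) (by omega)
  refine irregularAt_of_sparse 𝒜 u hxpos hℓp ?_ (by omega)
  calc (ℓ : ℝ) ≤ ((2 * (subsetCount 𝒜 x + 2) : ℕ) : ℝ) := by exact_mod_cast hle
    _ = 2 * ((subsetCount 𝒜 x : ℝ) + 2) := by push_cast; ring
    _ ≤ _ := hsp

/-- **The barrier restricted to the sparse regime is a theorem about ALL sets of naturals** (same
quantifier shape as `EquidistributionLimitBarrier`, primality dropped, sparseness added, `c = 1/2`
uniformly in `u`): at level `u` the catalogued barrier therefore constrains only sets with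
`limsup 𝒜(x)(log x)^u/x ≥ 1/2`. [folklore] -/
theorem equidistributionLimit_sparseRegime (u : ℝ) :
    ∃ c : ℝ, 0 < c ∧ ∀ 𝒜 : Set ℕ,
      (∀ᶠ x : ℝ in atTop, 2 * ((subsetCount 𝒜 x : ℝ) + 2) ≤ x / Real.log x ^ u) →
        ∃ x₀ : ℝ, ∀ x : ℝ, x₀ ≤ x → IrregularAt[𝒜, u, c, x] :=
  ⟨1 / 2, by norm_num, fun 𝒜 h𝒜 => irregular_of_eventually_sparse u 𝒜 h𝒜⟩

/-- **Polynomially sparse sets are void at every level**: if `𝒜(x) ≤ x^θ` for large `x` with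
`θ < 1` (prime values of a polynomial of degree `≥ 2`, any set with counting function `O(x^{1-δ})`),
then for EVERY `u` the conclusion of the barrier holds with `c = 1/2` at all large `x`. [folklore] -/
theorem irregular_of_rpow_bound (𝒜 : Set ℕ) {θ : ℝ} (hθ : θ < 1)
    (h : ∀ᶠ x : ℝ in atTop, (subsetCount 𝒜 x : ℝ) ≤ x ^ θ) (u : ℝ) :
    ∃ x₀ : ℝ, ∀ x : ℝ, x₀ ≤ x → IrregularAt[𝒜, u, (1 / 2 : ℝ), x] := by
  refine irregular_of_eventually_sparse u 𝒜 ?_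
  set θ' : ℝ := max θ (1 / 2) with hθ'
  have hθ'1 : θ' < 1 := max_lt hθ (by norm_num)
  have hδ : 0 < 1 - θ' := by linarith
  have hlo := (isLittleO_log_rpow_rpow_atTop u hδ).bound (by norm_num : (0 : ℝ) < 1 / 4)
  filter_upwards [h, hlo, eventually_ge_atTop (1 : ℝ), eventually_gt_atTop (Real.exp 1),
    (tendsto_rpow_atTop (by norm_num : (0 : ℝ) < 1 / 2)).eventually_ge_atTop 4]
    with x hA hx hx1 hxe hx4
  have hx0 : 0 < x := by linarith
  have hlogpos : 0 < Real.log x := by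
    have := Real.log_lt_log (Real.exp_pos 1) hxe
    rw [Real.log_exp] at this; linarith
  have hpow : 0 < Real.log x ^ u := Real.rpow_pos_of_pos hlogpos u
  rw [Real.norm_eq_abs, Real.norm_eq_abs, abs_of_pos hpow,
    abs_of_pos (Real.rpow_pos_of_pos hx0 _)] at hx
  have hA' : (subsetCount 𝒜 x : ℝ) ≤ x ^ θ' :=
    hA.trans (Real.rpow_le_rpow_of_exponent_le hx1 (le_max_left _ _))
  have hx4' : (4 : ℝ) ≤ x ^ θ' :=
    hx4.trans (Real.rpow_le_rpow_of_exponent_le hx1 (le_max_right _ _))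
  rw [le_div_iff₀ hpow]
  have h1 : 2 * ((subsetCount 𝒜 x : ℝ) + 2) ≤ 4 * x ^ θ' := by linarith
  calc 2 * ((subsetCount 𝒜 x : ℝ) + 2) * Real.log x ^ u
      ≤ (4 * x ^ θ') * (1 / 4 * x ^ (1 - θ')) :=
        mul_le_mul h1 hx hpow.le (by positivity)
    _ = x ^ θ' * x ^ (1 - θ') := by ring
    _ = x := by rw [← Real.rpow_add hx0]; norm_num

/-! ### Class-avoiding sets -/

/-- **Class-avoiding sets, at one scale.** If `𝒜` (any set of naturals) never meets the reduced
class `a (mod m)`, `1 ≤ m ≤ x/(log x)^u`, `x > 0`, then the conclusion of the barrier holds at `x`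
with `ℓ = m`, `c = 1/4` (`y = x/2`: `|0 - 𝒜(x)/(2φ(m))| ≥ 𝒜(x)/(4φ(m))`). The source's remark
about the primes `≡ 5 (mod 7)`. [cite: GranvilleSoundararajan2007Uncertainty, §1a] -/
theorem irregularAt_of_avoids_class (𝒜 : Set ℕ) (u : ℝ) {x : ℝ} (hx : 0 < x) {m a : ℕ}
    (hm : 1 ≤ m) (ha : a.Coprime m) (havoid : ∀ n ∈ 𝒜, ¬ n ≡ a [MOD m])
    (hmx : (m : ℝ) ≤ x / Real.log x ^ u) :
    IrregularAt[𝒜, u, (1 / 4 : ℝ), x] := by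
  have hzero : ∀ y : ℝ, subsetCountMod 𝒜 m a y = 0 := by
    intro y
    have hempty : {n : ℕ | n ∈ 𝒜 ∧ (n : ℝ) ≤ y ∧ n ≡ a [MOD m]} = ∅ := by
      ext n
      simp only [Set.mem_setOf_eq, Set.mem_empty_iff_false, iff_false, not_and]
      exact fun hn _ hmod => havoid n hn hmod
    simp [subsetCountMod, hempty]
  refine ⟨m, hm, hmx, x / 2, by linarith, by linarith, a, ha, ?_⟩
  rw [hzero (x / 2)]
  have hφ : (0 : ℝ) < Nat.totient m := by exact_mod_cast Nat.totient_pos.mpr hm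
  have hN : (0 : ℝ) ≤ subsetCount 𝒜 x := Nat.cast_nonneg _
  rw [Nat.cast_zero, zero_sub, abs_neg, abs_of_nonneg (by positivity)]
  rw [show 1 / (Nat.totient m : ℝ) * (x / 2 * (subsetCount 𝒜 x : ℝ) / x) =
      (1 / 2) * ((subsetCount 𝒜 x : ℝ) / Nat.totient m) by field_simp]
  gcongr
  norm_num

/-- Eventually `M ≤ x/(log x)^u` (every fixed modulus is admissible at large scales). [folklore] -/
theorem eventually_const_le_div_log_rpow (u M : ℝ) :
    ∀ᶠ x : ℝ in atTop, M ≤ x / Real.log x ^ u := by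
  have hlo := (isLittleO_log_rpow_rpow_atTop u (by norm_num : (0 : ℝ) < 1 / 2)).bound one_pos
  filter_upwards [hlo, eventually_ge_atTop (1 : ℝ), eventually_ge_atTop (M ^ 2),
    eventually_gt_atTop (Real.exp 1)] with x hx hx1 hxM hxe
  have hx0 : 0 < x := by linarith
  have hlogpos : 0 < Real.log x := by
    have := Real.log_lt_log (Real.exp_pos 1) hxe
    rw [Real.log_exp] at this; linarith
  have hpow : 0 < Real.log x ^ u := Real.rpow_pos_of_pos hlogpos u
  rw [one_mul, Real.norm_eq_abs, Real.norm_eq_abs, abs_of_pos hpow,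
    abs_of_pos (Real.rpow_pos_of_pos hx0 _)] at hx
  rw [le_div_iff₀ hpow]
  have hsqrt : x ^ (1 / 2 : ℝ) * x ^ (1 / 2 : ℝ) = x := by
    rw [← Real.rpow_add hx0]; norm_num
  by_cases hM : M ≤ 0
  · nlinarith [hpow.le]
  · push Not at hM
    have hMs : M ≤ x ^ (1 / 2 : ℝ) := by
      rw [show x ^ (1 / 2 : ℝ) = Real.sqrt x from (Real.sqrt_eq_rpow x).symm,
        show M = Real.sqrt (M ^ 2) from (Real.sqrt_sq hM.le).symm]
      exact Real.sqrt_le_sqrt hxM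
    calc M * Real.log x ^ u ≤ x ^ (1 / 2 : ℝ) * x ^ (1 / 2 : ℝ) :=
          mul_le_mul hMs hx hpow.le (Real.rpow_nonneg hx0.le _)
      _ = x := hsqrt

/-- **Class-avoiding sets, at every level.** A set of naturals missing a reduced class `a (mod m)`
satisfies the conclusion of `EquidistributionLimitBarrier` with `c = 1/4` for EVERY `u` and all
large `x`. [cite: GranvilleSoundararajan2007Uncertainty, §1a] -/
theorem irregular_of_avoids_class (𝒜 : Set ℕ) {m a : ℕ} (hm : 1 ≤ m) (ha : a.Coprime m)
    (havoid : ∀ n ∈ 𝒜, ¬ n ≡ a [MOD m]) (u : ℝ) :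
    ∃ x₀ : ℝ, ∀ x : ℝ, x₀ ≤ x → IrregularAt[𝒜, u, (1 / 4 : ℝ), x] := by
  obtain ⟨x₀, hx₀⟩ := eventually_atTop.mp
    ((eventually_const_le_div_log_rpow u m).and (eventually_gt_atTop 0))
  exact ⟨x₀, fun x hx =>
    irregularAt_of_avoids_class 𝒜 u (hx₀ x hx).2 hm ha havoid (hx₀ x hx).1⟩

/-- The lesser of a twin prime pair is never `≡ 1 (mod 3)` (else `3 ∣ p + 2`, `p + 2 = 3`, `p = 1`).
[folklore] -/
theorem not_modEq_one_three_of_twinPrime {p : ℕ} (hp : p.Prime) (hp2 : (p + 2).Prime) :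
    ¬ p ≡ 1 [MOD 3] := by
  intro h
  have h3 : 3 ∣ p + 2 := by
    have : p + 2 ≡ 1 + 2 [MOD 3] := Nat.ModEq.add_right 2 h
    exact Nat.modEq_zero_iff_dvd.mp (this.trans (by decide : 1 + 2 ≡ 0 [MOD 3]))
  have hp2eq : p + 2 = 3 := by
    rcases (Nat.dvd_prime hp2).mp h3 with h | h
    · norm_num at h
    · exact h.symm
  have : p = 1 := by omega
  exact hp.one_lt.ne' this

/-- **Twin primes.** Every subset of the lesser twin primes satisfies the conclusion of
`EquidistributionLimitBarrier` with `c = 1/4` at EVERY level `u` (take `ℓ = 3`, `a = 1`): for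
tuple-primes the catalogued barrier is void, as its scope caveat (e) says informally.
[cite: GranvilleSoundararajan2007Uncertainty, §1a] -/
theorem irregular_of_subset_twinPrimes (𝒜 : Set ℕ)
    (h𝒜 : ∀ p ∈ 𝒜, p.Prime ∧ (p + 2).Prime) (u : ℝ) :
    ∃ x₀ : ℝ, ∀ x : ℝ, x₀ ≤ x → IrregularAt[𝒜, u, (1 / 4 : ℝ), x] :=
  irregular_of_avoids_class 𝒜 (m := 3) (a := 1) (by norm_num) (by norm_num)
    (fun p hp => not_modEq_one_three_of_twinPrime (h𝒜 p hp).1 (h𝒜 p hp).2) u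

end Literature.Barriers.Parity

end
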